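import Literature.NumberTheory.DiophantineGeometry.GenEllDeFamilySlopeDefect
import Literature.NumberTheory.DiophantineGeometry.GenEllDeFamilyBadPrimesConverse
import Literature.NumberTheory.DiophantineGeometry.GenEllDeFamilyDefectChoice
import HarnessLib

/-!
# [GenEll] Thm. 2.1 on the `D_e` route, family `t_c`: the W5 conductor slope under ruling #7 with BOTH the
# converse direction and the defect inequality DISCHARGED (`R_c` split in `K`, `A ∋` the critical values)

S. Mochizuki, *Arithmetic elliptic curves in general position*, Math. J. Okayama Univ. **52** (2010), proof
of Thm. 2.1 p. 13 (Prop. 1.6 for the reduced divisor) [cite: MochizukiGenEll2010, Thm 2.1 proof p.13].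
Junction file (proof-only) for the abc-iut cell's route item `GenEllTwo` (stmt-ABC-19679), the L-level core
of «GenEllMechanismKappa»: `DeC.slope_of_crit_sep_two_defect` (`GenEllDeFamilySlopeDefect`, abc-iut-w5-d009;
separation at `2` only, per-prime defects at the other bad primes, B-free good places via
`DeC.ord_placewise_of_crit`) still takes as hypotheses the converse direction `hconvA` and the defect
inequality `hδ`. Both are tree theorems given that the critical-locus polynomial `R_c` splits in `K` and `A`
contains the critical values: `DeC.hconv_off_badPrimes` (abc-iut-w5-d054, `GenEllDeFamilyBadPrimesConverse`)
and `DeC.exists_defectFn_hdelta_of_crit` (`GenEllDeFamilyDefectChoice`, over abc-iut-w5-d090's bad-place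
defect and abc-iut-w5-d054's ramification divisibility). This file composes them:

* `DeC.slope_sep_two_of_splits` — `∃ S ∋ 2` (primes, depending on `(k, c, A)` only) and `∃ Dp : ℕ → ℕ`
  such that for every number field `L ⊇ K`, every `T ⊇ S` of primes, every point datum
  `(r, s, t, N, x)` of the family normal forms with `r s N ≠ 0`, every finite `B ⊇ A` (read in `L`) with
  `t ∉ B`, every finite `W` meeting `B` off `T`, and the remaining ANALYTIC inputs only — `hsep` (2-adic
  separation), `harch`, the height comparisons `htH`/`hNH` and `hBH` — the slope bound
  `(1/[L:ℚ]) Σ_{w∈W} log N(w) ≤ ((|B|(2k+4) − (6k+6))/(2k+1))·((1/[L:ℚ])·h_L(x)) + const` holds, with the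
  constant of `DeC.slope_of_crit_sep_two_defect`.

Nothing here bears on [IUTchIII] Cor. 3.12; classical.
-/

noncomputable section

namespace Literature.NumberTheory.DiophantineGeometry.GenEll

open _root_.Polynomial NumberField IsDedekindDomain
open Literature.IUT.LogVolume

universe u

open scoped Classical in
/-- **The W5 conductor slope for the family `t_c`, separation at `2` only, every W5-internal hypothesis
discharged.** `k ≥ 1`, `c ≠ 0` in a number field `K`, `R_c` split in `K`, `A ∋ tCritC c θ` for every root
`θ`. Then `∃ S ∋ 2` (primes) and `∃ Dp : ℕ → ℕ` such that for all `L ⊇ K`, `T ⊇ S` (primes), points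
`(r, s, t, N, x)` with `s² = 1 − 4r^{2k+1}`, `t·(rs) = s + c·r^{k+2}`, `N = N_c`, `r s N ≠ 0`, all finite
`B ⊇ A.map (K → L)` with `t ∉ B`, all `W` meeting `B` off `T`, and given `hsep` (`(2^{k₂})⁻¹ ≤ ‖σ N‖` for
every `σ : L → Q̄₂`), `harch`, `htH`, `hNH`, `hBH`:
`(1/[L:ℚ])·Σ_{w∈W} log N(w) ≤ ((|B|(2k+4) − (6k+6))/(2k+1))·((1/[L:ℚ])·h_L(x)) + ((|B|C₄+C₅)/(2k+1) +
|B|(C₆ + log 2) + (k₂ log 2 + Σ_{p∈T∖{2}} Dp p·log p) + (log 2 + Σ_{p∈T∖{2}} log p) + C₃)`.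
[cite: MochizukiGenEll2010, Thm 2.1 proof p.13] -/
theorem DeC.slope_sep_two_of_splits (k : ℕ) (hk : 1 ≤ k) {K : Type u} [Field K] [NumberField K]
    {c : K} (hc : c ≠ 0) (A : Finset K) (hsplit : (DeCrit.RpolyC k c).Splits)
    (hA : ∀ θ : K, (DeCrit.RpolyC k c).eval θ = 0 → DeCrit.tCritC k c θ ∈ A) :
    ∃ S : Finset ℕ, 2 ∈ S ∧ (∀ p ∈ S, p.Prime) ∧ ∃ Dp : ℕ → ℕ,
      ∀ (L : Type u) [Field L] [NumberField L] [Algebra K L] (T : Finset ℕ), S ⊆ T →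
        (∀ p ∈ T, p.Prime) →
        ∀ {r s t N x : L},
        s ^ 2 = 1 - 4 * r ^ (2 * k + 1) → t * (r * s) = s + algebraMap K L c * r ^ (k + 2) →
        N = -s ^ 3 + algebraMap K L c * ((k + 1) * r ^ (k + 2) - 2 * r ^ (3 * k + 3)) →
        r ≠ 0 → s ≠ 0 → N ≠ 0 →
        ∀ (B : Finset L), A.map ⟨algebraMap K L, (algebraMap K L).injective⟩ ⊆ B →
        (∀ b ∈ B, t ≠ b) →
        ∀ (W : Finset (HeightOneSpectrum (𝓞 L))) (k₂ : ℕ) {C₃ C₄ C₅ C₆ : ℝ},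
        (∀ w ∈ W, w ∉ T.attach.biUnion (fun p => placesOver L p.1) → ∃ b ∈ B, 0 < ord L w (t - b)) →
        (∀ σ : L →+* PadicAlgCl 2, ((2 : ℝ) ^ k₂)⁻¹ ≤ ‖σ N‖) →
        (∀ v : InfinitePlace L, Real.posLog (v N⁻¹) ≤ C₃) →
        ((2 * k + 1 : ℝ) * Height.logHeight₁ t ≤
          (2 * k + 4 : ℝ) * Height.logHeight₁ x + Module.finrank ℚ L * C₄) →
        ((6 * k + 6 : ℝ) * Height.logHeight₁ x ≤
          (2 * k + 1 : ℝ) * Height.logHeight₁ N + Module.finrank ℚ L * C₅) →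
        (∀ b ∈ B, Height.logHeight₁ b ≤ Module.finrank ℚ L * C₆) →
        (Module.finrank ℚ L : ℝ)⁻¹ * ∑ w ∈ W, logNorm L w ≤
          ((B.card * (2 * k + 4 : ℝ) - (6 * k + 6)) / (2 * k + 1)) *
              ((Module.finrank ℚ L : ℝ)⁻¹ * Height.logHeight₁ x) +
            ((B.card * C₄ + C₅) / (2 * k + 1) + B.card * (C₆ + Real.log 2) +
              ((k₂ : ℝ) * Real.log 2 + ∑ p ∈ T.erase 2, (Dp p : ℝ) * Real.log p) +
              (Real.log 2 + ∑ p ∈ T.erase 2, Real.log p) + C₃) := by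
  -- the bad primes of the slope core and of the converse direction
  obtain ⟨S₁, h2S₁, hS₁p, hS₁⟩ := DeC.slope_of_crit_sep_two_defect (K := K) k hc A
  have hcritB : ∀ θ : K, (DeCrit.RpolyC k c).eval θ = 0 →
      ((1 - 2 * DeCrit.critXC k c θ) + c * θ ^ (k + 2)) / (θ * (1 - 2 * DeCrit.critXC k c θ)) ∈ A := by
    intro θ hθ
    have h := hA θ hθ
    rwa [← DeCrit.tC_critPointC (two_ne_zero : (2 : K) ≠ 0) c θ] at h
  obtain ⟨S₂, -, hS₂p, hS₂⟩ := DeC.hconv_off_badPrimes (K := K) k hc A hsplit hcritB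
  -- the defect function, chosen once for all primes
  obtain ⟨Dp, hDp⟩ := DeC.exists_defectFn_hdelta_of_crit.{u, u} k hk hc A hsplit hA
  refine ⟨S₁ ∪ S₂, Finset.mem_union_left _ h2S₁, fun p hp => ?_, Dp, ?_⟩
  · rcases Finset.mem_union.mp hp with h | h
    · exact hS₁p p h
    · exact hS₂p p h
  intro L _ _ _ T hST hT r s t N x hcurve ht hN hr hs hN0 B hAB htB W k₂ C₃ C₄ C₅ C₆ hW hsep harch
    htH hNH hBH
  have hS₁T : S₁ ⊆ T := fun p hp => hST (Finset.mem_union_left _ hp)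
  have hS₂T : S₂ ⊆ T := fun p hp => hST (Finset.mem_union_right _ hp)
  exact hS₁ L T hS₁T hT hcurve ht hN hN0 B hAB htB W k₂ Dp
    (fun w hw hNlt => hS₂ L T hS₂T w hw hcurve ht hN hNlt) hW hsep
    (hDp L r s t N hcurve ht hN hr hs hN0 B hAB htB T hT) harch htH hNH hBH

end Literature.NumberTheory.DiophantineGeometry.GenEll

end
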